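import Mathlib
import Summits.Ventures.HodgeRepro2.T5SU11Unimodular
import Summits.Ventures.HodgeRepro2.T5BergmanCoefficient
import Summits.Ventures.HodgeRepro2.T5BergmanMatrixCoeff
import Summits.Ventures.HodgeRepro2.T5BergmanIntegrableKFinite
import Summits.Ventures.HodgeRepro2.Tier7.Line3.ModularGroupCount

/-!
# Tier 7 — LINE 3 support: the weight-`k` Poincaré series of the modular group in the Bergman model, `k ≥ 3`
(`Line3/BergmanPoincare.lean`; t7-L1-p1, gen 2; p1's Cayley / Bergman modules + Line3/ModularGroupCount)

The line's test function at a `(1,1)`-place (L3-ARGUMENT §2g, plan-3 l. 15167) is the ONE-vector coefficient of the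
lowest-weight vector of the weight-`k` Bergman model of `SU(1,1)`: `f(g) = ⟨π_k(g) 1, 1⟩_k = a(g)^{−k} ⟨1, 1⟩_k`
(p1's `T5BergmanCoefficient.pairing_act_lowest`, `norm_pairing_act_lowest`), with `SU(1,1) = cayleyHom.range` the Cayley
image of `SL(2, ℝ)` (p1's `T5SU11Unimodular`). This file puts the real `SL(2, ℤ)`, the real `SL(2, ℝ)` and the real `f`
together: transported to `SL(2, ℝ)` by the Cayley homomorphism, `|a(cay x)|² = (κ x + 1)/2` (`normSq_mat_cay_00`: the
explicit `cayleyA` + `HyperbolicSize.κ_eq`), so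
  `‖f (cay x)‖ = 2^{k/2} ‖⟨1,1⟩_k‖ · (1 + κ x)^{−k/2}`   (`norm_bergmanCoeff`),
the decay hypothesis of `ModularGroupCount.continuous_kernelSum_SL2Z'` with `α = k/2`, which exceeds the sharp count
exponent `β = 1` exactly when `k ≥ 3`. CONCLUSION (`continuous_bergmanPoincare`, `summable_norm_bergmanPoincare`): for
`k ≥ 3` the Poincaré series `Σ_{γ ∈ SL(2, ℤ)} ⟨π_k(cay(x⁻¹ γ y)) 1, 1⟩_k` converges absolutely at every `(x, y)` and is
continuous on `SL(2, ℝ) × SL(2, ℝ)` — the classical convergence of weight-`k > 2` Poincaré series, in the kernel, for the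
line's own `f` (weight 3 included). At this one `(1,1)`-place nothing is left in words on the group, the lattice or the
test function; the cell's real lattice `U(W_A)(F)` is not `SL(2, ℤ)` and the three places are not one (TYPING-CENSUS T7).

Sorry-free; axioms: propext / Classical.choice / Quot.sound. §8(d): uses an L-value-free non-vanishing device: NO.
-/

namespace Summit.Ventures.HodgeRepro2.Tier7.Line3.BergmanPoincare

open Summit.Ventures.HodgeRepro2.T5SU11Unimodular Summit.Ventures.HodgeRepro2.T5CayleySU11
  Summit.Ventures.HodgeRepro2.T5BergmanCoefficient Summit.Ventures.HodgeRepro2.T5BergmanMatrixCoeff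
  HyperbolicSize HyperbolicLatticeCount ModularGroupCount Summit.Ventures.HodgeRepro2.Tier7.Line3.PoincareKernel
open scoped MatrixGroups

/-- the Cayley image of `x ∈ SL(2, ℝ)` in `SU(1,1) = cayleyHom.range`. -/
noncomputable def cay (x : SL(2, ℝ)) : SU11 := ⟨cayleyHom x, ⟨x, rfl⟩⟩

/-- the `(0,0)` entry of the Cayley image: `cayleyA` of the entries of `x`. -/
theorem mat_cay_00 (x : SL(2, ℝ)) : mat (cay x) 0 0 = cayleyA (x 0 0) (x 0 1) (x 1 0) (x 1 1) := by
  show ((cayleyHom x : SL(2, ℂ)) : Matrix (Fin 2) (Fin 2) ℂ) 0 0 = _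
  rw [coe_cayleyHom, map_ofReal_eq, cayleyConj_real]
  simp

/-- **`|a(cay x)|² = (κ x + 1) / 2`**: the Cayley `a`-entry against the hyperbolic cosh-size (`ad − bc = 1`). -/
theorem normSq_mat_cay_00 (x : SL(2, ℝ)) : Complex.normSq (mat (cay x) 0 0) = (κ x + 1) / 2 := by
  rw [mat_cay_00, κ_eq, cayleyA, Complex.normSq_add_mul_I]
  have := det_entries x
  nlinarith [this]

/-- `mat (cay x) 0 0 ≠ 0`. -/
theorem mat_cay_00_ne_zero (x : SL(2, ℝ)) : mat (cay x) 0 0 ≠ 0 := by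
  intro h
  have := normSq_mat_cay_00 x
  rw [h, map_zero] at this
  linarith [one_le_κ x]

/-- `‖mat (cay x) 0 0‖ = √((κ x + 1)/2)`. -/
theorem norm_mat_cay_00 (x : SL(2, ℝ)) : ‖mat (cay x) 0 0‖ = Real.sqrt ((κ x + 1) / 2) := by
  rw [← normSq_mat_cay_00, Complex.norm_def]

/-- `x ↦ mat (cay x) 0 0` is continuous (affine in the entries of `x`). -/
theorem continuous_mat_cay_00 : Continuous fun x : SL(2, ℝ) => mat (cay x) 0 0 := by
  simp_rw [mat_cay_00]
  unfold cayleyA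
  have h : ∀ i j, Continuous fun x : SL(2, ℝ) => x i j := fun i j =>
    (continuous_subtype_val.matrix_elem i j)
  fun_prop

/-- the line's test function, transported to `SL(2, ℝ)`: `x ↦ ⟨π_k(cay x) 1, 1⟩_k`. -/
noncomputable def bergmanCoeff (k : ℕ) (x : SL(2, ℝ)) : ℂ := matrixCoeff k lowest lowest (cay x)

/-- `bergmanCoeff k x = a(cay x)^{−k} ⟨1, 1⟩_k`. -/
theorem bergmanCoeff_eq (k : ℕ) (x : SL(2, ℝ)) :
    bergmanCoeff k x = (mat (cay x) 0 0)⁻¹ ^ k * pairing k lowest lowest :=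
  pairing_act_lowest k (cay x)

/-- the test function is continuous. -/
theorem continuous_bergmanCoeff (k : ℕ) : Continuous (bergmanCoeff k) := by
  have h : bergmanCoeff k = fun x => (mat (cay x) 0 0)⁻¹ ^ k * pairing k lowest lowest :=
    funext (bergmanCoeff_eq k)
  rw [h]
  exact ((continuous_mat_cay_00.inv₀ mat_cay_00_ne_zero).pow k).mul continuous_const

/-- **THE DECAY**: `‖bergmanCoeff k x‖ = 2^{k/2} ‖⟨1,1⟩_k‖ (1 + κ x)^{−k/2}`. -/
theorem norm_bergmanCoeff (k : ℕ) (x : SL(2, ℝ)) :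
    ‖bergmanCoeff k x‖ = (2 : ℝ) ^ ((k : ℝ) / 2) * ‖pairing k lowest lowest‖ * (1 + κ x) ^ (-((k : ℝ) / 2)) := by
  rw [bergmanCoeff_eq, norm_mul, norm_pow, norm_inv, norm_mat_cay_00]
  have hκ : 0 < 1 + κ x := by linarith [one_le_κ x]
  have hs : 0 < (1 + κ x) / 2 := by positivity
  have key : (Real.sqrt ((κ x + 1) / 2))⁻¹ ^ k = (2 : ℝ) ^ ((k : ℝ) / 2) * (1 + κ x) ^ (-((k : ℝ) / 2)) := by
    rw [add_comm (κ x) 1, Real.sqrt_eq_rpow, ← Real.rpow_neg hs.le, ← Real.rpow_natCast, ← Real.rpow_mul hs.le,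
      Real.div_rpow hκ.le (by norm_num)]
    have e1 : (-(1 / 2 : ℝ) * (k : ℝ)) = -((k : ℝ) / 2) := by ring
    rw [e1, Real.rpow_neg (by norm_num : (0 : ℝ) ≤ 2), div_inv_eq_mul, mul_comm]
  rw [key]
  ring

variable (f : SL(2, ℝ) → ℂ)

/-- **ABSOLUTE CONVERGENCE of the weight-`k` Poincaré series**, `k ≥ 3`, at every `(x, y)`. -/
theorem summable_norm_bergmanPoincare {k : ℕ} (hk : 3 ≤ k) (x y : SL(2, ℝ)) :
    Summable fun γ : SL(2, ℤ) => ‖bergmanCoeff k (x⁻¹ * ιZ γ * y)‖ := by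
  have hα : (1 : ℝ) < (k : ℝ) / 2 := by
    have : (3 : ℝ) ≤ k := by exact_mod_cast hk
    linarith
  exact summable_norm_kernel_SL2Z' (bergmanCoeff k) hα
    (C := (2 : ℝ) ^ ((k : ℝ) / 2) * ‖pairing k lowest lowest‖) (fun g => (norm_bergmanCoeff k g).le) x y

/-- **THE WEIGHT-`k` POINCARÉ SERIES OF `SL(2, ℤ)` IS CONTINUOUS FOR `k ≥ 3`**:
`(x, y) ↦ Σ'_{γ ∈ SL(2, ℤ)} ⟨π_k(cay(x⁻¹ γ y)) 1, 1⟩_k` is continuous on `SL(2, ℝ) × SL(2, ℝ)`. -/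
theorem continuous_bergmanPoincare {k : ℕ} (hk : 3 ≤ k) :
    Continuous (fun p : SL(2, ℝ) × SL(2, ℝ) => kernelSum ιZ (bergmanCoeff k) p.1 p.2) := by
  have hα : (1 : ℝ) < (k : ℝ) / 2 := by
    have : (3 : ℝ) ≤ k := by exact_mod_cast hk
    linarith
  exact continuous_kernelSum_SL2Z' (bergmanCoeff k) (continuous_bergmanCoeff k) hα
    (C := (2 : ℝ) ^ ((k : ℝ) / 2) * ‖pairing k lowest lowest‖) (fun g => (norm_bergmanCoeff k g).le)

/-! ## 2. `K`-finite vectors: the Poincaré series of `⟨π_k(·) S, T⟩_k` for polynomials `S, T` (v2, append-only)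

The A-adapted weight vector of memo §4a is a `K`-type of `D_k` — for `π⁰_triv` (`k = 3`) the vector `z` (`K`-type `5`), not the
constant `1`; so the line's `f` is a coefficient of POLYNOMIAL vectors in general. p1's `norm_matrixCoeff_partialSum_partialSum_le`
(T5BergmanIntegrableKFinite) gives the same `|a(g)|^{−k}` decay for any two polynomials `S = Σ_{m<N} a_m z^m`, `T = Σ_{n<M} b_n z^n`,
and `continuous_matrixCoeff_of_bounded` their continuity; everything of §1 goes through with the constant `polyDecayConst`. -/

open Summit.Ventures.HodgeRepro2.T5BergmanParseval Summit.Ventures.HodgeRepro2.T5BergmanIntegrableKFinite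

/-- the Cayley map `SL(2, ℝ) → SU(1,1)` is continuous (conjugation by a fixed matrix, entrywise). -/
theorem continuous_cay : Continuous cay := by
  refine continuous_induced_rng.2 ?_
  refine continuous_induced_rng.2 ?_
  change Continuous (fun x : SL(2, ℝ) => (((cay x : SU11) : SL(2, ℂ)) : Matrix (Fin 2) (Fin 2) ℂ))
  have h : (fun x : SL(2, ℝ) => (((cay x : SU11) : SL(2, ℂ)) : Matrix (Fin 2) (Fin 2) ℂ)) =
      fun x : SL(2, ℝ) => cayley * ((x : Matrix (Fin 2) (Fin 2) ℝ).map Complex.ofReal) * cayleyInv := by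
    funext x
    show ((cayleyHom x : SL(2, ℂ)) : Matrix (Fin 2) (Fin 2) ℂ) = _
    rw [coe_cayleyHom]
    rfl
  rw [h]
  exact (continuous_const.matrix_mul (continuous_subtype_val.matrix_map Complex.continuous_ofReal)).matrix_mul
    continuous_const

/-- `|a(cay x)|^{−k} = 2^{k/2} (1 + κ x)^{−k/2}` (the decay factor, isolated). -/
theorem inv_norm_mat_cay_00_pow (k : ℕ) (x : SL(2, ℝ)) :
    ‖mat (cay x) 0 0‖⁻¹ ^ k = (2 : ℝ) ^ ((k : ℝ) / 2) * (1 + κ x) ^ (-((k : ℝ) / 2)) := by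
  rw [norm_mat_cay_00]
  have hκ : 0 < 1 + κ x := by linarith [one_le_κ x]
  have hs : 0 < (1 + κ x) / 2 := by positivity
  rw [add_comm (κ x) 1, Real.sqrt_eq_rpow, ← Real.rpow_neg hs.le, ← Real.rpow_natCast, ← Real.rpow_mul hs.le,
    Real.div_rpow hκ.le (by norm_num)]
  have e1 : (-(1 / 2 : ℝ) * (k : ℝ)) = -((k : ℝ) / 2) := by ring
  rw [e1, Real.rpow_neg (by norm_num : (0 : ℝ) ≤ 2), div_inv_eq_mul, mul_comm]

/-- the coefficient of two polynomial (`K`-finite) vectors, transported to `SL(2, ℝ)`: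
`x ↦ ⟨π_k(cay x) (Σ_{m<N} a_m z^m), Σ_{n<M} b_n z^n⟩_k`. -/
noncomputable def bergmanCoeffPoly (k : ℕ) (a b : ℕ → ℂ) (N M : ℕ) (x : SL(2, ℝ)) : ℂ :=
  matrixCoeff k (partialSum a N) (partialSum b M) (cay x)

/-- the polynomial coefficient is continuous (p1's `continuous_matrixCoeff_of_bounded` on the bounded polynomials). -/
theorem continuous_bergmanCoeffPoly (k : ℕ) (a b : ℕ → ℂ) (N M : ℕ) :
    Continuous (bergmanCoeffPoly k a b N M) :=
  (continuous_matrixCoeff_of_bounded k _ _ (differentiable_partialSum a N).continuous.continuousOn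
    (differentiable_partialSum b M).continuous.continuousOn (fun _ hw => norm_partialSum_le a N hw)
    (fun _ hw => norm_partialSum_le b M hw)).comp continuous_cay

/-- **THE DECAY for `K`-finite vectors**: `‖bergmanCoeffPoly k a b N M x‖ ≤ C (1 + κ x)^{−k/2}`, `k ≥ 2`. -/
theorem norm_bergmanCoeffPoly_le (k : ℕ) (hk : 2 ≤ k) (a b : ℕ → ℂ) (N M : ℕ) (x : SL(2, ℝ)) :
    ‖bergmanCoeffPoly k a b N M x‖ ≤
      (polyDecayConst k a b N M * (2 : ℝ) ^ ((k : ℝ) / 2)) * (1 + κ x) ^ (-((k : ℝ) / 2)) := by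
  have h := norm_matrixCoeff_partialSum_partialSum_le k hk a b N M (cay x)
  rw [inv_norm_mat_cay_00_pow] at h
  calc ‖bergmanCoeffPoly k a b N M x‖ = ‖matrixCoeff k (partialSum a N) (partialSum b M) (cay x)‖ := rfl
    _ ≤ polyDecayConst k a b N M * ((2 : ℝ) ^ ((k : ℝ) / 2) * (1 + κ x) ^ (-((k : ℝ) / 2))) := h
    _ = (polyDecayConst k a b N M * (2 : ℝ) ^ ((k : ℝ) / 2)) * (1 + κ x) ^ (-((k : ℝ) / 2)) := by ring

/-- **ABSOLUTE CONVERGENCE** of the Poincaré series of any two `K`-finite vectors, `k ≥ 3`. -/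
theorem summable_norm_bergmanPoincarePoly {k : ℕ} (hk : 3 ≤ k) (a b : ℕ → ℂ) (N M : ℕ) (x y : SL(2, ℝ)) :
    Summable fun γ : SL(2, ℤ) => ‖bergmanCoeffPoly k a b N M (x⁻¹ * ιZ γ * y)‖ := by
  have hα : (1 : ℝ) < (k : ℝ) / 2 := by
    have : (3 : ℝ) ≤ k := by exact_mod_cast hk
    linarith
  exact summable_norm_kernel_SL2Z' (bergmanCoeffPoly k a b N M) hα
    (C := polyDecayConst k a b N M * (2 : ℝ) ^ ((k : ℝ) / 2))
    (norm_bergmanCoeffPoly_le k (by omega) a b N M) x y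

/-- **THE POINCARÉ SERIES OF ANY TWO `K`-FINITE VECTORS IS CONTINUOUS FOR `k ≥ 3`**:
`(x, y) ↦ Σ'_{γ ∈ SL(2, ℤ)} ⟨π_k(cay(x⁻¹ γ y)) S, T⟩_k` on `SL(2, ℝ) × SL(2, ℝ)` — in particular for the A-adapted
weight vector `u_A = z` of `D_3` (memo §4a) and for every `K`-type of `D_k`. -/
theorem continuous_bergmanPoincarePoly {k : ℕ} (hk : 3 ≤ k) (a b : ℕ → ℂ) (N M : ℕ) :
    Continuous (fun p : SL(2, ℝ) × SL(2, ℝ) => kernelSum ιZ (bergmanCoeffPoly k a b N M) p.1 p.2) := by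
  have hα : (1 : ℝ) < (k : ℝ) / 2 := by
    have : (3 : ℝ) ≤ k := by exact_mod_cast hk
    linarith
  exact continuous_kernelSum_SL2Z' (bergmanCoeffPoly k a b N M) (continuous_bergmanCoeffPoly k a b N M) hα
    (C := polyDecayConst k a b N M * (2 : ℝ) ^ ((k : ℝ) / 2))
    (norm_bergmanCoeffPoly_le k (by omega) a b N M)

end Summit.Ventures.HodgeRepro2.Tier7.Line3.BergmanPoincare
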